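import Mathlib
import Literature.AlgebraicGeometry.Resolution.NonRationalShiftSurvival
import Literature.AlgebraicGeometry.Resolution.NonRationalStepPrepared
import Literature.AlgebraicGeometry.Resolution.PointStepPrepared
import Literature.AlgebraicGeometry.Resolution.InitialFormsChangeOfParameters
import Literature.AlgebraicGeometry.Resolution.VertexDissolution
import HarnessLib

/-!
# One point blowing up at a NON-RATIONAL very near point: the prepared `β`-drop, solvable case and
# the full step

Topic: `Literature/AlgebraicGeometry/Resolution`. The non-rational point step of Cossart–Piltant 2008,
proof of Lemma 4.5 (2), pp. 12–14 («we now assume that `x′` is not rational over `x`. The problem is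
that, in general, `Δ(E′; u′₁, v′; z′)` is not prepared … let `w′ = z′ + θ′` be such that
`Δ(E′; u′₁, v′; w′)` is prepared», (18)–(25)) and of Cossart–Jannsen–Saito, LNM 2270, Ch. 14 =
arXiv 0905.2191 §13 (Proposition 14.3, Theorem 14.4 «`β_{x_q}(X_q, Z_q) < β_x(X, Z)`», Lemmas
14.7–14.11), when the transported system `c′ = (y′, φ u₁, P(t))` IS solvable at its vertex `v′`.
We follow a variant of CJS's route that stays at `x′`: ITERATED DISSOLUTION with polynomial lifts
`A(t)`, `deg Ā < d` (`hκ : k(x′) = k(x)(t̄)`, CJS (C1)–(C3)), each step `Ψ ↦ Ψ + A·P^b`; the line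
`x₁ = δ − 1` always survives with `d·β ≤ max(γ⁺, L·deg Ψ̄)` (`exists_pts_line_nr_shift`), the integer
values satisfy `L d b ≤ γ⁺s` and strictly increase, and the terminal system is `𝐯`-prepared with
`β⋆ < β` (`β > 1` as `α < 1`, `δ ≥ 2`, `d ≥ 2`). ASSEMBLY of PROVED tree lemmas (no facts, no
definitions): `exists_pts_line_nr_shift`, `VertexDissolution.{span_triple_shiftZ,
forall_pts_shiftZ_of_forall_pts, lt_of_mem_pts_shiftZ_of_isSolvableAt}`, `hironakaTauAt_eq_of_rsop`,
`hasMonic_of_sub_mem_weightedIdealW`, `exists_readapt`, `exists_wMinusPrepared`, and case (A)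
`exists_prepared_label_nonRationalStep_of_vPrepared`:

* `shiftZ_shiftMon_nr_shift`, `shiftZ_shiftMon_nr_zero` — bookkeeping of shifted systems;
* `exists_lift_natDegree_lt` — lifts `λ = Ā(t̄)`, `deg Ā < d`, from `hκ`;
* `alphaS_betaS_of_line_point`, `nr_shift_step` (ONE DISSOLUTION, `β` strictly up), `nr_shift_iterate`;
* `exists_prepared_label_nonRationalStep_of_not_vPrepared` — **case (B)**;
* `exists_prepared_label_nonRationalStep` — **THE NON-RATIONAL POINT STEP**: input at `x` a label
  `c = (y, u₁, u₂)`, `J ⊆ 𝔪^μ` of order exactly `μ`, adapted, `w⁻`-prepared, quasi-isolated; the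
  non-rational chart of degree `d ≥ 2` with `k(x′) = k(x)(t̄)`; `J′` very near (`J′ ⊆ 𝔪′^μ`, `τ′ = 1`).
  Output: an adapted, `𝐯`- and `w⁻`-prepared label at `x′` with `α⋆ + L = δ` and **`β⋆ < β`**.

AI-written; weaker than expert review.

## Sources

* V. Cossart, O. Piltant, J. Algebra 320 (2008), proof of Lemma 4.5 (2), pp. 12–14, (16)–(25).
  [CossartPiltant2008]
* V. Cossart, U. Jannsen, S. Saito, LNM 2270 (2020), Ch. 14: Prop. 14.3, Thm. 14.4, Lemmas 14.7–14.11.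
  [CossartJannsenSaito2020]
-/

noncomputable section

open IsLocalRing MvPolynomial

namespace Literature.AlgebraicGeometry.Resolution

universe u

section NonRationalStepB

variable {R R' : Type u} [CommRing R] [CommRing R'] (φ : R →+* R') {c : Fin 3 → R}
  {c' : Fin 3 → R'} (h₁ : c' 1 = φ (c 1)) (h₀ : φ (c 0) = φ (c 1) * c' 0) {t : R'}
  (ht : φ (c 2) = φ (c 1) * t) {P : Polynomial R} (hP : c' 2 = Polynomial.eval₂ φ t P)
  [IsRegularLocalRing R] [IsRegularLocalRing R']
  (hgen : Ideal.span {c 0, c 1, c 2} = maximalIdeal R) (hdim : ringKrullDim R = 3)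
  (hgen' : Ideal.span {c' 0, c' 1, c' 2} = maximalIdeal R') (hdim' : ringKrullDim R' = 3)
  (hres : ∀ G : Polynomial R, Polynomial.eval₂ φ t G ∈ maximalIdeal R' ↔
    Polynomial.map (residue R) P ∣ Polynomial.map (residue R) G)
  {J : Ideal R} {μ : ℕ}

/-! ## The shifted systems `cΨ = (y′ + u₁′^{a₀} Ψ(t), u₁′, φ′)` -/

omit [IsRegularLocalRing R] [IsRegularLocalRing R'] in
/-- Dissolving the shifted system `(y′ + u₁′^{a₀}Ψ(t), u₁′, P(t))` at `(a₀, b)` with the scalar `A(t)`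
is the shifted system of `Ψ + A·P^b`. [cite: CossartJannsenSaito2020, (14.15)–(14.16)] -/
theorem shiftZ_shiftMon_nr_shift (hP : c' 2 = Polynomial.eval₂ φ t P) (Ψ A : Polynomial R) (a₀ b : ℕ) :
    shiftZ (shiftZ c' (shiftMon c' (Polynomial.eval₂ φ t Ψ) a₀ 0))
        (shiftMon (shiftZ c' (shiftMon c' (Polynomial.eval₂ φ t Ψ) a₀ 0))
          (Polynomial.eval₂ φ t A) a₀ b) =
      shiftZ c' (shiftMon c' (Polynomial.eval₂ φ t (Ψ + A * P ^ b)) a₀ 0) := by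
  funext i
  fin_cases i
  · simp only [shiftZ, shiftMon, Fin.zero_eta, Matrix.cons_val_zero, Matrix.cons_val_one,
      Matrix.cons_val_two, Matrix.head_cons, Matrix.tail_cons, Polynomial.eval₂_add,
      Polynomial.eval₂_mul, Polynomial.eval₂_pow, ← hP]
    ring
  · rfl
  · rfl

omit [IsRegularLocalRing R] [IsRegularLocalRing R'] in
/-- The unshifted system: `Ψ = 0` gives back `c′`. [cite: CossartJannsenSaito2020, Lemma 14.1] -/
theorem shiftZ_shiftMon_nr_zero (a₀ : ℕ) :
    shiftZ c' (shiftMon c' (Polynomial.eval₂ φ t (0 : Polynomial R)) a₀ 0) = c' := by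
  funext i
  fin_cases i
  · simp [shiftZ, shiftMon]
  · rfl
  · rfl

include h₁ h₀ ht hP hgen hgen' in
/-- **Polynomial lifts of residues of degree `< d`** (CJS (C1)–(C3)): if `k(x′)` is generated by `t̄`
over `k(x)` (`hκ`), every `λ ∈ k(x′)` is the residue of `A(t)` with `deg Ā < d = deg P̄`
(divide by `P̄`; `P(t) ∈ 𝔪′`). [cite: CossartJannsenSaito2020, Lemma 14.8, (C1)–(C3)] -/
theorem exists_lift_natDegree_lt
    (hd : 1 ≤ (Polynomial.map (residue R) P).natDegree)
    (hκ : ∀ r : ResidueField R', ∃ G : Polynomial R, residue R' (Polynomial.eval₂ φ t G) = r)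
    (lam : ResidueField R') :
    ∃ A : Polynomial R, (Polynomial.map (residue R) A).natDegree + 1 ≤
        (Polynomial.map (residue R) P).natDegree ∧
      residue R' (Polynomial.eval₂ φ t A) = lam := by
  classical
  obtain ⟨G, hG⟩ := hκ lam
  set Pb := Polynomial.map (residue R) P with hPb
  have hPb0 : Pb ≠ 0 := fun h => by rw [h, Polynomial.natDegree_zero] at hd; omega
  -- divide `Ḡ` by `P̄` in `k[T]`
  set Gb := Polynomial.map (residue R) G with hGb
  set Qb := Gb / Pb with hQb
  set Rb := Gb % Pb with hRb
  have hdiv : Rb + Pb * Qb = Gb := by rw [hRb, hQb]; exact EuclideanDomain.mod_add_div Gb Pb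
  have hRdeg : Rb.degree < Pb.degree := by rw [hRb]; exact EuclideanDomain.mod_lt Gb hPb0
  -- lift `R̄b` (same degree) and `Q̄b`
  obtain ⟨A, hAmap, hAdeg⟩ := Polynomial.exists_natDegree_eq_of_mem_lifts
    (Polynomial.mem_lifts_of_surjective (f := residue R) residue_surjective Rb)
  obtain ⟨Q, hQ⟩ := Polynomial.map_surjective (residue R) residue_surjective Qb
  refine ⟨A, ?_, ?_⟩
  · -- degree bound
    rw [hAmap]
    rcases eq_or_ne Rb 0 with h0 | h0
    · rw [h0, Polynomial.natDegree_zero]; omega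
    · have := Polynomial.natDegree_lt_natDegree h0 hRdeg; omega
  · -- `G - A - P Q` has coefficients in `𝔪`, and `P(t) ∈ 𝔪′`
    have hdiff : ∀ n, (G - A - P * Q).coeff n ∈ maximalIdeal R := by
      rw [← polynomial_map_residue_eq_zero_iff]
      rw [Polynomial.map_sub, Polynomial.map_sub, Polynomial.map_mul, hAmap, hQ, ← hPb, ← hGb, ← hdiv]
      ring
    have hc'1 : c' 1 ∈ maximalIdeal R' := hgen' ▸ Ideal.subset_span (by simp)
    have hc'2 : c' 2 ∈ maximalIdeal R' := hgen' ▸ Ideal.subset_span (by simp)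
    have hmem : Polynomial.eval₂ φ t (G - A - P * Q) ∈ maximalIdeal R' := by
      have h1 := eval₂_mem_map_of_forall_coeff_mem φ hdiff t
      have h2 : (maximalIdeal R).map φ ≤ maximalIdeal R' :=
        (map_maximalIdeal_le_span_nr φ hgen h₀ ht).trans
          ((Ideal.span_singleton_le_iff_mem _).mpr (h₁ ▸ hc'1))
      exact h2 h1
    have hPt : Polynomial.eval₂ φ t (P * Q) ∈ maximalIdeal R' := by
      rw [Polynomial.eval₂_mul, ← hP]; exact Ideal.mul_mem_right _ _ hc'2
    have hGA : Polynomial.eval₂ φ t G - Polynomial.eval₂ φ t A ∈ maximalIdeal R' := by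
      have : Polynomial.eval₂ φ t G - Polynomial.eval₂ φ t A =
          Polynomial.eval₂ φ t (G - A - P * Q) + Polynomial.eval₂ φ t (P * Q) := by
        simp only [Polynomial.eval₂_sub]; ring
      rw [this]; exact Ideal.add_mem _ hmem hPt
    rw [← hG, eq_comm, ← sub_eq_zero, ← map_sub, residue_eq_zero_iff]
    exact hGA


/-! ## Reading `α, β` of a shifted system -/

omit [IsRegularLocalRing R] [IsRegularLocalRing R'] in
/-- From the family of half-planes `K (δs − L) ≤ K x₁ + x₂` (`K ≥ 1`) and a line point with
`d x₂ ≤ M`: the shifted system has `α + L = δs` and `d β ≤ M`. [cite: CossartJannsenSaito2020, (14.25)–(14.26)] -/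
theorem alphaS_betaS_of_line_point {cs : Fin 3 → R'} {I : Ideal R'} {δs L d M : ℕ}
    (hhalf : ∀ K, 0 < K → ∀ e ∈ pts cs I μ, K * (δs - L) ≤ K * spt₁ μ e + 1 * spt₂ μ e)
    {e₀ : Fin 3 →₀ ℕ} (he₀ : e₀ ∈ pts cs I μ) (h1 : spt₁ μ e₀ + L = δs) (h2 : d * spt₂ μ e₀ ≤ M) :
    alphaS cs I μ + L = δs ∧ d * betaS cs I μ ≤ M := by
  have hlow : ∀ e ∈ pts cs I μ, δs - L ≤ spt₁ μ e := by
    intro e he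
    have := hhalf (spt₂ μ e + 1) (by omega) e he
    by_contra hlt
    push Not at hlt
    have h3 : (spt₂ μ e + 1) * (spt₁ μ e + 1) ≤ (spt₂ μ e + 1) * (δs - L) :=
      Nat.mul_le_mul_left _ hlt
    rw [Nat.mul_add, mul_one] at h3
    omega
  obtain ⟨ea, hea, hea1⟩ := exists_pts_alphaS ⟨e₀, he₀⟩
  have hα : alphaS cs I μ = δs - L := by
    refine le_antisymm ?_ ?_
    · have := alphaS_le he₀; omega
    · rw [← hea1]; exact hlow ea hea
  refine ⟨by omega, ?_⟩
  have hβ : betaS cs I μ ≤ spt₂ μ e₀ := betaS_le he₀ (by omega)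
  exact (Nat.mul_le_mul_left _ hβ).trans h2

/-! ## One dissolution step -/

include h₁ h₀ ht hP hgen hdim hgen' hdim' hres in
/-- **One dissolution at `x′` with a polynomial lift** (CJS Lemma 14.8 / (14.16)): if the shifted
system for `Ψ` (with the bookkeeping invariants) is not `𝐯`-prepared, the solvable vertex is
`(a₀, b)` with `L d b ≤ γ⁺s`; dissolving it with `A(t)`, `deg Ā < d`, gives the shifted system for
`Ψ + A P^b`, with the invariants and a STRICTLY larger `β`. [cite: CossartJannsenSaito2020, Lemma 14.8] -/
theorem nr_shift_step (hd : 2 ≤ (Polynomial.map (residue R) P).natDegree)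
    (hκ : ∀ r : ResidueField R', ∃ G : Polynomial R, residue R' (Polynomial.eval₂ φ t G) = r)
    (hJμ : J ≤ maximalIdeal R ^ μ) (hne : (pts c J μ).Nonempty) (hδ : μ.factorial < deltaS c J μ)
    (hwprep : WMinusPrepared c J μ) {a₀ : ℕ} (ha₀ : deltaS c J μ = μ.factorial * (a₀ + 1))
    (Ψ : Polynomial R) (B : ℕ)
    (hB : μ.factorial * ((Polynomial.map (residue R) P).natDegree * B) ≤ gammaPlusS c J μ)
    (hdeg : (Polynomial.map (residue R) Ψ).natDegree + 1 ≤
      (Polynomial.map (residue R) P).natDegree * (B + 1))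
    (hβlow : μ.factorial * B ≤ betaS (shiftZ c' (shiftMon c' (Polynomial.eval₂ φ t Ψ) a₀ 0)) (Submodule.colon (Ideal.map φ J) ({φ (c 1) ^ μ} : Set R')) μ)
    (hhalf : ∀ K, 0 < K → ∀ e ∈ pts (shiftZ c' (shiftMon c' (Polynomial.eval₂ φ t Ψ) a₀ 0)) (Submodule.colon (Ideal.map φ J) ({φ (c 1) ^ μ} : Set R')) μ,
      K * (deltaS c J μ - μ.factorial) ≤ K * spt₁ μ e + 1 * spt₂ μ e)
    (hgenΨ : Ideal.span {shiftZ c' (shiftMon c' (Polynomial.eval₂ φ t Ψ) a₀ 0) 0,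
      shiftZ c' (shiftMon c' (Polynomial.eval₂ φ t Ψ) a₀ 0) 1,
      shiftZ c' (shiftMon c' (Polynomial.eval₂ φ t Ψ) a₀ 0) 2} = maximalIdeal R')
    (hv : ¬ VPrepared (shiftZ c' (shiftMon c' (Polynomial.eval₂ φ t Ψ) a₀ 0)) (Submodule.colon (Ideal.map φ J) ({φ (c 1) ^ μ} : Set R')) μ) :
    ∃ (Ψ' : Polynomial R) (B' : ℕ),
      μ.factorial * ((Polynomial.map (residue R) P).natDegree * B') ≤ gammaPlusS c J μ ∧
      (Polynomial.map (residue R) Ψ').natDegree + 1 ≤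
        (Polynomial.map (residue R) P).natDegree * (B' + 1) ∧
      μ.factorial * B' ≤ betaS (shiftZ c' (shiftMon c' (Polynomial.eval₂ φ t Ψ') a₀ 0)) (Submodule.colon (Ideal.map φ J) ({φ (c 1) ^ μ} : Set R')) μ ∧
      (∀ K, 0 < K → ∀ e ∈ pts (shiftZ c' (shiftMon c' (Polynomial.eval₂ φ t Ψ') a₀ 0)) (Submodule.colon (Ideal.map φ J) ({φ (c 1) ^ μ} : Set R')) μ,
        K * (deltaS c J μ - μ.factorial) ≤ K * spt₁ μ e + 1 * spt₂ μ e) ∧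
      Ideal.span {shiftZ c' (shiftMon c' (Polynomial.eval₂ φ t Ψ') a₀ 0) 0,
        shiftZ c' (shiftMon c' (Polynomial.eval₂ φ t Ψ') a₀ 0) 1,
        shiftZ c' (shiftMon c' (Polynomial.eval₂ φ t Ψ') a₀ 0) 2} = maximalIdeal R' ∧
      (Polynomial.map (residue R) P).natDegree *
          betaS (shiftZ c' (shiftMon c' (Polynomial.eval₂ φ t Ψ) a₀ 0)) (Submodule.colon (Ideal.map φ J) ({φ (c 1) ^ μ} : Set R')) μ +
        (Polynomial.map (residue R) P).natDegree ≤
        (Polynomial.map (residue R) P).natDegree *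
          betaS (shiftZ c' (shiftMon c' (Polynomial.eval₂ φ t Ψ') a₀ 0)) (Submodule.colon (Ideal.map φ J) ({φ (c 1) ^ μ} : Set R')) μ ∧
      (Polynomial.map (residue R) P).natDegree *
          betaS (shiftZ c' (shiftMon c' (Polynomial.eval₂ φ t Ψ) a₀ 0)) (Submodule.colon (Ideal.map φ J) ({φ (c 1) ^ μ} : Set R')) μ ≤ gammaPlusS c J μ := by
  classical
  set cs := shiftZ c' (shiftMon c' (Polynomial.eval₂ φ t Ψ) a₀ 0) with hcs
  have hLpos : 0 < μ.factorial := Nat.factorial_pos μ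
  have hPu : ¬ IsUnit (Polynomial.map (residue R) P) := fun hu => by
    have := Polynomial.natDegree_eq_zero_of_isUnit hu; omega
  have ha₀pos : 0 < a₀ := by
    by_contra h0
    have : a₀ = 0 := by omega
    rw [this, zero_add, mul_one] at ha₀; omega
  -- the current line point and `α, β`
  obtain ⟨e₀, he₀, he₀1, he₀2⟩ := exists_pts_line_nr_shift φ h₁ h₀ ht hP hgen hdim hgen' hdim' hres
    (by omega) hJμ hne hδ hwprep ha₀ Ψ
  obtain ⟨hα, hβM⟩ := alphaS_betaS_of_line_point (μ := μ) hhalf he₀ he₀1 he₀2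
  have hneΨ : (pts cs (Submodule.colon (Ideal.map φ J) ({φ (c 1) ^ μ} : Set R')) μ).Nonempty := ⟨e₀, he₀⟩
  -- the solvable vertex
  unfold VPrepared at hv
  push Not at hv
  obtain ⟨v₁, b, lam, hαv, hβv, hsol⟩ := hv
  have hv₁ : v₁ = a₀ := by
    apply Nat.eq_of_mul_eq_mul_left hLpos
    have : alphaS cs (Submodule.colon (Ideal.map φ J) ({φ (c 1) ^ μ} : Set R')) μ + μ.factorial = μ.factorial * (a₀ + 1) := by rw [hα, ← ha₀]
    rw [hαv, Nat.mul_succ] at this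
    omega
  subst v₁
  -- `b ≥ B` and `μ.factorial (Polynomial.map (residue R) P).natDegree b ≤ gammaPlusS c J μ`
  have hbB : B ≤ b := by
    have : μ.factorial * B ≤ μ.factorial * b := by rw [← hβv]; exact hβlow
    exact Nat.le_of_mul_le_mul_left this hLpos
  have hdb : μ.factorial * ((Polynomial.map (residue R) P).natDegree * b) ≤ gammaPlusS c J μ := by
    have h1 : (Polynomial.map (residue R) P).natDegree * (μ.factorial * b) ≤ max (gammaPlusS c J μ) (μ.factorial * (Polynomial.map (residue R) Ψ).natDegree) := by
      rw [← hβv]; exact hβM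
    rcases le_or_gt (μ.factorial * (Polynomial.map (residue R) Ψ).natDegree) (gammaPlusS c J μ) with hle | hlt
    · rw [max_eq_left hle] at h1
      calc μ.factorial * ((Polynomial.map (residue R) P).natDegree * b) = (Polynomial.map (residue R) P).natDegree * (μ.factorial * b) := by ring
        _ ≤ gammaPlusS c J μ := h1
    · rw [max_eq_right hlt.le] at h1
      -- `(Polynomial.map (residue R) P).natDegree μ.factorial b ≤ μ.factorial deg Ψ̄ ≤ μ.factorial ((Polynomial.map (residue R) P).natDegree (B+1) - 1) < μ.factorial (Polynomial.map (residue R) P).natDegree (B + 1)`, so `b ≤ B`, so `b = B`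
      have h2 : (Polynomial.map (residue R) P).natDegree * (μ.factorial * b) < μ.factorial * ((Polynomial.map (residue R) P).natDegree * (B + 1)) := by
        have h3 : μ.factorial * (Polynomial.map (residue R) Ψ).natDegree < μ.factorial * ((Polynomial.map (residue R) P).natDegree * (B + 1)) :=
          Nat.mul_lt_mul_of_pos_left (by omega) hLpos
        omega
      have h4 : μ.factorial * ((Polynomial.map (residue R) P).natDegree * b) < μ.factorial * ((Polynomial.map (residue R) P).natDegree * (B + 1)) := by
        calc μ.factorial * ((Polynomial.map (residue R) P).natDegree * b) = (Polynomial.map (residue R) P).natDegree * (μ.factorial * b) := by ring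
          _ < μ.factorial * ((Polynomial.map (residue R) P).natDegree * (B + 1)) := h2
      have h5 : (Polynomial.map (residue R) P).natDegree * b < (Polynomial.map (residue R) P).natDegree * (B + 1) := Nat.lt_of_mul_lt_mul_left h4
      have h6 : b < B + 1 := Nat.lt_of_mul_lt_mul_left h5
      have hbeq : b = B := le_antisymm (by omega) hbB
      rw [hbeq]; exact hB
  -- lift `λ`
  obtain ⟨A, hAdeg, hAres⟩ := exists_lift_natDegree_lt φ h₁ h₀ ht hP hgen hgen' (by omega) hκ lam
  -- the dissolved system
  set Ψ' : Polynomial R := Ψ + A * P ^ b with hΨ'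
  have hsys : shiftZ cs (shiftMon cs (Polynomial.eval₂ φ t A) a₀ b) =
      shiftZ c' (shiftMon c' (Polynomial.eval₂ φ t Ψ') a₀ 0) :=
    shiftZ_shiftMon_nr_shift φ hP Ψ A a₀ b
  have hvpos : 0 < a₀ + b := by omega
  -- the realised vertex `(a₀, b)` of `cs`
  obtain ⟨ev, hev, hev1, hev2⟩ := exists_pts_v hneΨ
  rw [hαv] at hev1
  rw [hβv] at hev2
  -- generation of `𝔪′`
  have hgen'' : Ideal.span {shiftZ c' (shiftMon c' (Polynomial.eval₂ φ t Ψ') a₀ 0) 0,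
      shiftZ c' (shiftMon c' (Polynomial.eval₂ φ t Ψ') a₀ 0) 1,
      shiftZ c' (shiftMon c' (Polynomial.eval₂ φ t Ψ') a₀ 0) 2} = maximalIdeal R' := by
    rw [← hsys, span_triple_shiftZ cs _ hvpos]; exact hgenΨ
  -- half-planes transfer
  have hhalf' : ∀ K, 0 < K → ∀ e ∈ pts (shiftZ c' (shiftMon c' (Polynomial.eval₂ φ t Ψ') a₀ 0)) (Submodule.colon (Ideal.map φ J) ({φ (c 1) ^ μ} : Set R')) μ,
      K * (deltaS c J μ - μ.factorial) ≤ K * spt₁ μ e + 1 * spt₂ μ e := by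
    intro K hK
    rw [← hsys]
    exact forall_pts_shiftZ_of_forall_pts cs hgenΨ hdim' _ hvpos hev hev1 hev2
      (Nat.mul_pos hK (by omega)) hK Nat.one_pos (hhalf K hK)
  -- degree bookkeeping
  have hPbdeg : ∀ n : ℕ, (Polynomial.map (residue R) P ^ n).natDegree ≤ (Polynomial.map (residue R) P).natDegree * n := by
    intro n
    calc (Polynomial.map (residue R) P ^ n).natDegree ≤ n * (Polynomial.map (residue R) P).natDegree :=
          Polynomial.natDegree_pow_le
      _ = (Polynomial.map (residue R) P).natDegree * n := by rw [mul_comm]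
  have hdeg' : (Polynomial.map (residue R) Ψ').natDegree + 1 ≤ (Polynomial.map (residue R) P).natDegree * (b + 1) := by
    rw [hΨ', Polynomial.map_add, Polynomial.map_mul, Polynomial.map_pow]
    have h1 := Polynomial.natDegree_add_le (Polynomial.map (residue R) Ψ)
      (Polynomial.map (residue R) A * Polynomial.map (residue R) P ^ b)
    have h2 : (Polynomial.map (residue R) A * Polynomial.map (residue R) P ^ b).natDegree ≤
        (Polynomial.map (residue R) A).natDegree + (Polynomial.map (residue R) P).natDegree * b :=
      Polynomial.natDegree_mul_le.trans (by have := hPbdeg b; omega)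
    have h3 : (Polynomial.map (residue R) Ψ).natDegree + 1 ≤ (Polynomial.map (residue R) P).natDegree * (b + 1) :=
      hdeg.trans (Nat.mul_le_mul_left _ (by omega))
    have h4 : (Polynomial.map (residue R) A).natDegree + (Polynomial.map (residue R) P).natDegree * b + 1 ≤ (Polynomial.map (residue R) P).natDegree * (b + 1) := by
      rw [Nat.mul_succ]; omega
    rcases le_total (Polynomial.map (residue R) Ψ).natDegree
        (Polynomial.map (residue R) A * Polynomial.map (residue R) P ^ b).natDegree with hle | hle
    · rw [max_eq_right hle] at h1; omega
    · rw [max_eq_left hle] at h1; omega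
  -- the new `β` is strictly larger: the vertex was dissolved along the canonical steep line
  have hsteep := steepN cs (Submodule.colon (Ideal.map φ J) ({φ (c 1) ^ μ} : Set R')) μ
  have hline : vLevel cs (Submodule.colon (Ideal.map φ J) ({φ (c 1) ^ μ} : Set R')) μ = μ.factorial * (steepN cs (Submodule.colon (Ideal.map φ J) ({φ (c 1) ^ μ} : Set R')) μ * a₀ + 1 * b) := by
    rw [vLevel, hαv, hβv]; ring
  have hw₀ : 0 < vLevel cs (Submodule.colon (Ideal.map φ J) ({φ (c 1) ^ μ} : Set R')) μ := by
    rw [hline]; exact Nat.mul_pos hLpos (by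
      have : 0 < steepN cs (Submodule.colon (Ideal.map φ J) ({φ (c 1) ^ μ} : Set R')) μ * a₀ := Nat.mul_pos (by rw [steepN]; omega) ha₀pos
      omega)
  have hsolv' : IsSolvableAt cs (Submodule.colon (Ideal.map φ J) ({φ (c 1) ^ μ} : Set R')) (levelWeight μ (vLevel cs (Submodule.colon (Ideal.map φ J) ({φ (c 1) ^ μ} : Set R')) μ) (steepN cs (Submodule.colon (Ideal.map φ J) ({φ (c 1) ^ μ} : Set R')) μ) 1)
      (vLevel cs (Submodule.colon (Ideal.map φ J) ({φ (c 1) ^ μ} : Set R')) μ * μ) μ (vexp a₀ b) (residue R' (Polynomial.eval₂ φ t A)) := by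
    rw [hAres]; exact hsol
  have hlt := lt_of_mem_pts_shiftZ_of_isSolvableAt cs hgenΨ hdim' (Polynomial.eval₂ φ t A) hvpos
    hev hev1 hev2 hw₀ (by rw [steepN]; omega) Nat.one_pos hline (forall_pts_vWeight) hsolv'
  rw [hsys] at hlt
  -- the new line point and the new `α`
  obtain ⟨e₁, he₁, he₁1, he₁2⟩ := exists_pts_line_nr_shift φ h₁ h₀ ht hP hgen hdim hgen' hdim' hres
    (by omega) hJμ hne hδ hwprep ha₀ Ψ'
  obtain ⟨hα', -⟩ := alphaS_betaS_of_line_point (μ := μ) hhalf' he₁ he₁1 he₁2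
  obtain ⟨ev', hev', hev'1, hev'2⟩ := exists_pts_v (⟨e₁, he₁⟩ : (pts _ (Submodule.colon (Ideal.map φ J) ({φ (c 1) ^ μ} : Set R')) μ).Nonempty)
  have hβ'gt : μ.factorial * b < betaS (shiftZ c' (shiftMon c' (Polynomial.eval₂ φ t Ψ') a₀ 0)) (Submodule.colon (Ideal.map φ J) ({φ (c 1) ^ μ} : Set R')) μ := by
    have h1 := hlt ev' hev'
    rw [hev'1, hev'2, hline] at h1
    have hα'' : alphaS (shiftZ c' (shiftMon c' (Polynomial.eval₂ φ t Ψ') a₀ 0)) (Submodule.colon (Ideal.map φ J) ({φ (c 1) ^ μ} : Set R')) μ = μ.factorial * a₀ := by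
      have : alphaS (shiftZ c' (shiftMon c' (Polynomial.eval₂ φ t Ψ') a₀ 0)) (Submodule.colon (Ideal.map φ J) ({φ (c 1) ^ μ} : Set R')) μ + μ.factorial = μ.factorial * (a₀ + 1) := by
        rw [hα', ← ha₀]
      rw [Nat.mul_succ] at this
      omega
    rw [hα''] at h1
    have h2 : μ.factorial * (steepN cs (Submodule.colon (Ideal.map φ J) ({φ (c 1) ^ μ} : Set R')) μ * a₀ + 1 * b) = steepN cs (Submodule.colon (Ideal.map φ J) ({φ (c 1) ^ μ} : Set R')) μ * (μ.factorial * a₀) + μ.factorial * b := by ring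
    rw [h2] at h1
    omega
  refine ⟨Ψ', b, hdb, hdeg', hβ'gt.le, hhalf', hgen'', ?_, ?_⟩
  · rw [hβv]
    have : (Polynomial.map (residue R) P).natDegree * (μ.factorial * b) + (Polynomial.map (residue R) P).natDegree ≤ (Polynomial.map (residue R) P).natDegree * (μ.factorial * b + 1) := by rw [Nat.mul_succ]
    exact this.trans (Nat.mul_le_mul_left _ hβ'gt)
  · rw [hβv]
    calc (Polynomial.map (residue R) P).natDegree * (μ.factorial * b) = μ.factorial * ((Polynomial.map (residue R) P).natDegree * b) := by ring
      _ ≤ gammaPlusS c J μ := hdb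


/-! ## The iteration -/

include h₁ h₀ ht hP hgen hdim hgen' hdim' hres in
/-- **Iterated dissolution terminates** at a `𝐯`-prepared shifted system (fuel
`γ⁺s + dL − d·βs`, which drops by `≥ d` at each dissolution). [cite: CossartJannsenSaito2020, Lemma 14.8] -/
theorem nr_shift_iterate (hd : 2 ≤ (Polynomial.map (residue R) P).natDegree)
    (hκ : ∀ r : ResidueField R', ∃ G : Polynomial R, residue R' (Polynomial.eval₂ φ t G) = r)
    (hJμ : J ≤ maximalIdeal R ^ μ) (hne : (pts c J μ).Nonempty) (hδ : μ.factorial < deltaS c J μ)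
    (hwprep : WMinusPrepared c J μ) {a₀ : ℕ} (ha₀ : deltaS c J μ = μ.factorial * (a₀ + 1)) :
    ∀ (n : ℕ) (Ψ : Polynomial R) (B : ℕ),
      μ.factorial * ((Polynomial.map (residue R) P).natDegree * B) ≤ gammaPlusS c J μ →
      (Polynomial.map (residue R) Ψ).natDegree + 1 ≤
        (Polynomial.map (residue R) P).natDegree * (B + 1) →
      μ.factorial * B ≤ betaS (shiftZ c' (shiftMon c' (Polynomial.eval₂ φ t Ψ) a₀ 0)) (Submodule.colon (Ideal.map φ J) ({φ (c 1) ^ μ} : Set R')) μ →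
      (∀ K, 0 < K → ∀ e ∈ pts (shiftZ c' (shiftMon c' (Polynomial.eval₂ φ t Ψ) a₀ 0)) (Submodule.colon (Ideal.map φ J) ({φ (c 1) ^ μ} : Set R')) μ,
        K * (deltaS c J μ - μ.factorial) ≤ K * spt₁ μ e + 1 * spt₂ μ e) →
      Ideal.span {shiftZ c' (shiftMon c' (Polynomial.eval₂ φ t Ψ) a₀ 0) 0,
        shiftZ c' (shiftMon c' (Polynomial.eval₂ φ t Ψ) a₀ 0) 1,
        shiftZ c' (shiftMon c' (Polynomial.eval₂ φ t Ψ) a₀ 0) 2} = maximalIdeal R' →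
      gammaPlusS c J μ + (Polynomial.map (residue R) P).natDegree * μ.factorial -
          (Polynomial.map (residue R) P).natDegree *
            betaS (shiftZ c' (shiftMon c' (Polynomial.eval₂ φ t Ψ) a₀ 0)) (Submodule.colon (Ideal.map φ J) ({φ (c 1) ^ μ} : Set R')) μ ≤ n →
      ∃ (Ψ' : Polynomial R) (B' : ℕ),
        μ.factorial * ((Polynomial.map (residue R) P).natDegree * B') ≤ gammaPlusS c J μ ∧
        (Polynomial.map (residue R) Ψ').natDegree + 1 ≤
          (Polynomial.map (residue R) P).natDegree * (B' + 1) ∧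
        (∀ K, 0 < K → ∀ e ∈ pts (shiftZ c' (shiftMon c' (Polynomial.eval₂ φ t Ψ') a₀ 0)) (Submodule.colon (Ideal.map φ J) ({φ (c 1) ^ μ} : Set R')) μ,
          K * (deltaS c J μ - μ.factorial) ≤ K * spt₁ μ e + 1 * spt₂ μ e) ∧
        Ideal.span {shiftZ c' (shiftMon c' (Polynomial.eval₂ φ t Ψ') a₀ 0) 0,
          shiftZ c' (shiftMon c' (Polynomial.eval₂ φ t Ψ') a₀ 0) 1,
          shiftZ c' (shiftMon c' (Polynomial.eval₂ φ t Ψ') a₀ 0) 2} = maximalIdeal R' ∧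
        VPrepared (shiftZ c' (shiftMon c' (Polynomial.eval₂ φ t Ψ') a₀ 0)) (Submodule.colon (Ideal.map φ J) ({φ (c 1) ^ μ} : Set R')) μ := by
  intro n
  induction n with
  | zero =>
    intro Ψ B hB hdeg hβlow hhalf hgenΨ hfuel
    by_cases hv : VPrepared (shiftZ c' (shiftMon c' (Polynomial.eval₂ φ t Ψ) a₀ 0)) (Submodule.colon (Ideal.map φ J) ({φ (c 1) ^ μ} : Set R')) μ
    · exact ⟨Ψ, B, hB, hdeg, hhalf, hgenΨ, hv⟩
    · exfalso
      obtain ⟨-, -, -, -, -, -, -, -, hβΓ⟩ := nr_shift_step φ h₁ h₀ ht hP hgen hdim hgen' hdim' hres hd hκ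
        hJμ hne hδ hwprep ha₀ Ψ B hB hdeg hβlow hhalf hgenΨ hv
      have : 0 < (Polynomial.map (residue R) P).natDegree * μ.factorial :=
        Nat.mul_pos (by omega) (Nat.factorial_pos μ)
      omega
  | succ n ih =>
    intro Ψ B hB hdeg hβlow hhalf hgenΨ hfuel
    by_cases hv : VPrepared (shiftZ c' (shiftMon c' (Polynomial.eval₂ φ t Ψ) a₀ 0)) (Submodule.colon (Ideal.map φ J) ({φ (c 1) ^ μ} : Set R')) μ
    · exact ⟨Ψ, B, hB, hdeg, hhalf, hgenΨ, hv⟩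
    · obtain ⟨Ψ', B', hB', hdeg', hβlow', hhalf', hgen'', hinc, hβΓ⟩ := nr_shift_step φ h₁ h₀ ht hP hgen
        hdim hgen' hdim' hres hd hκ hJμ hne hδ hwprep ha₀ Ψ B hB hdeg hβlow hhalf hgenΨ hv
      exact ih Ψ' B' hB' hdeg' hβlow' hhalf' hgen'' (by omega)

/-! ## Case (B) of the non-rational point step -/

include h₁ h₀ ht hP hgen hdim hgen' hdim' hres in
/-- **B6-nr, case (B): the transported system is solvable at `v′`** (CJS Lemmas 14.7–14.11 / CoP1
(23)–(25), via iterated dissolution at `x′` with polynomial lifts of degree `< d`): ends at a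
`𝐯`-prepared shifted system `(y′ + u₁′^{δ−1}Ψ(t), u₁′, P(t))` with `α⋆ + L = δ` and `β⋆ < β`; then
re-adaptation and `w⁻`-preparation. Uses `w⁻`-preparedness at `x` and `hκ : k(x′) = k(x)(t̄)`.
[cite: CossartJannsenSaito2020, Lemma 14.8] [cite: CossartPiltant2008, Lemma 4.5 (2), (23)–(25)] -/
theorem exists_prepared_label_nonRationalStep_of_not_vPrepared
    {J'' : Ideal R'} (hJ'def : J'' = Submodule.colon (Ideal.map φ J) ({φ (c 1) ^ μ} : Set R'))
    (hd : 2 ≤ (Polynomial.map (residue R) P).natDegree)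
    (hκ : ∀ r : ResidueField R', ∃ G : Polynomial R, residue R' (Polynomial.eval₂ φ t G) = r)
    (hJμ : J ≤ maximalIdeal R ^ μ) (hord : ∃ g ∈ J, g ∉ maximalIdeal R ^ (μ + 1))
    (hne : (pts c J μ).Nonempty) (hδ : μ.factorial < deltaS c J μ) (hα : alphaS c J μ < μ.factorial)
    (hwprep : WMinusPrepared c J μ)
    (hJμ' : J'' ≤ maximalIdeal R' ^ μ) (hτ' : hironakaTauAt c' J'' μ = 1)
    (hsolv : ¬ VPrepared c' J'' μ) :
    ∃ cs : Fin 3 → R', cs 1 = c' 1 ∧ cs 2 = c' 2 ∧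
      cs 0 - c' 0 ∈ Ideal.span {c' 1} ⊔ maximalIdeal R' ^ 2 ∧
      Ideal.span {cs 0, cs 1, cs 2} = maximalIdeal R' ∧ (pts cs J'' μ).Nonempty ∧
      μ.factorial < deltaS cs J'' μ ∧ VPrepared cs J'' μ ∧ WMinusPrepared cs J'' μ ∧
      (∃ g ∈ J'', g ∉ maximalIdeal R' ^ (μ + 1)) ∧
      alphaS cs J'' μ + μ.factorial = deltaS c J μ ∧ betaS cs J'' μ < betaS c J μ := by
  classical
  subst hJ'def
  have hLpos : 0 < μ.factorial := Nat.factorial_pos μ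
  have hPu : ¬ IsUnit (Polynomial.map (residue R) P) := fun hu => by
    have := Polynomial.natDegree_eq_zero_of_isUnit hu; omega
  -- the raw transported system
  obtain ⟨hne', hα', -⟩ := alphaS_nr_add_and_mul_betaS_le φ h₁ h₀ ht hP hgen hdim hgen' hdim' hres
    hPu (by omega) hJμ hne hδ
  -- the solvable vertex of `c′`: `δ = a₀ + 1 ∈ ℕ`
  have hsolv' := hsolv
  unfold VPrepared at hsolv'
  push Not at hsolv'
  obtain ⟨a₀, b₀, lam₀, hαv, -, -⟩ := hsolv'
  have ha₀ : deltaS c J μ = μ.factorial * (a₀ + 1) := by rw [← hα', hαv]; ring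
  have ha₀pos : 0 < a₀ := by
    by_contra h0
    have : a₀ = 0 := by omega
    rw [this, zero_add, mul_one] at ha₀; omega
  -- start of the iteration: `Ψ = 0`
  have hsys0 : shiftZ c' (shiftMon c' (Polynomial.eval₂ φ t (0 : Polynomial R)) a₀ 0) = c' :=
    shiftZ_shiftMon_nr_zero φ a₀
  have hhalf0 : ∀ K, 0 < K → ∀ e ∈ pts (shiftZ c' (shiftMon c' (Polynomial.eval₂ φ t (0 : Polynomial R)) a₀ 0)) (Submodule.colon (Ideal.map φ J) ({φ (c 1) ^ μ} : Set R')) μ,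
      K * (deltaS c J μ - μ.factorial) ≤ K * spt₁ μ e + 1 * spt₂ μ e := by
    intro K hK e he
    rw [hsys0] at he
    have := deltaS_le_spt₁_nr_add φ h₁ h₀ ht hgen hdim hgen' hdim' hδ he
    have h1 : K * (deltaS c J μ - μ.factorial) ≤ K * spt₁ μ e := Nat.mul_le_mul_left _ (by omega)
    omega
  obtain ⟨Ψ, B, hB, hdeg, hhalf, hgenΨ, hv⟩ := nr_shift_iterate φ h₁ h₀ ht hP hgen hdim hgen' hdim' hres
    hd hκ hJμ hne hδ hwprep ha₀ _ 0 0 (by simp) (by rw [Polynomial.map_zero, Polynomial.natDegree_zero]; omega)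
    (by simp) hhalf0 (by rw [hsys0]; exact hgen') le_rfl
  set cs := shiftZ c' (shiftMon c' (Polynomial.eval₂ φ t Ψ) a₀ 0) with hcs
  -- the terminal line point: `α⋆ + L = δ`, `d β⋆ ≤ max(γ⁺, L deg Ψ̄)`
  obtain ⟨e₀, he₀, he₀1, he₀2⟩ := exists_pts_line_nr_shift φ h₁ h₀ ht hP hgen hdim hgen' hdim' hres
    (by omega) hJμ hne hδ hwprep ha₀ Ψ
  obtain ⟨hαs, hβM⟩ := alphaS_betaS_of_line_point (μ := μ) hhalf he₀ he₀1 he₀2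
  have hnes : (pts cs (Submodule.colon (Ideal.map φ J) ({φ (c 1) ^ μ} : Set R')) μ).Nonempty := ⟨e₀, he₀⟩
  -- `β⋆ < β`
  have hβlt : betaS cs (Submodule.colon (Ideal.map φ J) ({φ (c 1) ^ μ} : Set R')) μ < betaS c J μ := by
    have hγβ := gammaPlusS_le_betaS (c := c) (J := J) (μ := μ) hne
    have hδαβ := deltaS_le_alphaS_add_betaS (c := c) (J := J) (μ := μ) hne
    have hβbig : μ.factorial < betaS c J μ := by
      have : μ.factorial * 2 ≤ μ.factorial * (a₀ + 1) := Nat.mul_le_mul_left _ (by omega)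
      omega
    have h2d : 2 * betaS cs (Submodule.colon (Ideal.map φ J) ({φ (c 1) ^ μ} : Set R')) μ ≤ (Polynomial.map (residue R) P).natDegree * betaS cs (Submodule.colon (Ideal.map φ J) ({φ (c 1) ^ μ} : Set R')) μ :=
      Nat.mul_le_mul_right _ hd
    rcases le_or_gt (μ.factorial * (Polynomial.map (residue R) Ψ).natDegree) (gammaPlusS c J μ)
      with hle | hlt
    · rw [max_eq_left hle] at hβM
      omega
    · rw [max_eq_right hlt.le] at hβM
      -- `d β⋆ ≤ L deg Ψ̄ < L d (B + 1)`, so `β⋆ < L (B + 1)`; and `2 L B ≤ d L B ≤ γ⁺ ≤ β`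
      have h3 : μ.factorial * (Polynomial.map (residue R) Ψ).natDegree <
          μ.factorial * ((Polynomial.map (residue R) P).natDegree * (B + 1)) :=
        Nat.mul_lt_mul_of_pos_left (by omega) hLpos
      have h4 : (Polynomial.map (residue R) P).natDegree * betaS cs (Submodule.colon (Ideal.map φ J) ({φ (c 1) ^ μ} : Set R')) μ <
          (Polynomial.map (residue R) P).natDegree * (μ.factorial * (B + 1)) := by
        calc (Polynomial.map (residue R) P).natDegree * betaS cs (Submodule.colon (Ideal.map φ J) ({φ (c 1) ^ μ} : Set R')) μ
            ≤ μ.factorial * (Polynomial.map (residue R) Ψ).natDegree := hβM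
          _ < μ.factorial * ((Polynomial.map (residue R) P).natDegree * (B + 1)) := h3
          _ = (Polynomial.map (residue R) P).natDegree * (μ.factorial * (B + 1)) := by ring
      have h5 : betaS cs (Submodule.colon (Ideal.map φ J) ({φ (c 1) ^ μ} : Set R')) μ < μ.factorial * (B + 1) := Nat.lt_of_mul_lt_mul_left h4
      have h6 : 2 * (μ.factorial * B) ≤ μ.factorial * ((Polynomial.map (residue R) P).natDegree * B) := by
        calc 2 * (μ.factorial * B) = μ.factorial * (2 * B) := by ring
          _ ≤ μ.factorial * ((Polynomial.map (residue R) P).natDegree * B) :=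
            Nat.mul_le_mul_left _ (Nat.mul_le_mul_right _ hd)
      rw [Nat.mul_succ] at h5
      rcases Nat.eq_zero_or_pos B with hB0 | hBpos
      · rw [hB0, mul_zero, zero_add] at h5; omega
      · have h7 : μ.factorial ≤ μ.factorial * B := Nat.le_mul_of_pos_right _ hBpos
        omega
  -- `τ = 1` for the shifted system (independence of the parameters)
  have hd3 : (maximalIdeal R').spanFinrank = 3 := by
    have h := IsRegularLocalRing.spanFinrank_maximalIdeal (R := R')
    rw [hdim'] at h
    exact_mod_cast h
  have hτs : hironakaTauAt cs (Submodule.colon (Ideal.map φ J) ({φ (c 1) ^ μ} : Set R')) μ = 1 := by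
    rw [hironakaTauAt_eq_of_rsop hd3 (span_range_eq_of_span_triple c' hgen')
      (span_range_eq_of_span_triple cs hgenΨ) (Submodule.colon (Ideal.map φ J) ({φ (c 1) ^ μ} : Set R')) μ]
    exact hτ'
  -- a monic element for the shifted system
  have hmons : HasMonic cs (Submodule.colon (Ideal.map φ J) ({φ (c 1) ^ μ} : Set R')) μ := by
    haveI := isDomain_of_isRegularLocalRing R'
    obtain ⟨g, hgJ, hg⟩ := hord
    obtain ⟨f, hfu, hgr⟩ := exists_monic_of_lt_deltaS c hgen hdim hJμ hδ hgJ hg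
    obtain ⟨g', hg'⟩ := exists_eq_pow_mul_of_mem_pow_nr φ h₀ ht hgen (hJμ hgJ)
    have hg'J : g' ∈ (Submodule.colon (Ideal.map φ J) ({φ (c 1) ^ μ} : Set R')) := by
      rw [Submodule.mem_colon_singleton, smul_eq_mul, mul_comm, ← hg']
      exact Ideal.mem_map_of_mem _ hgJ
    obtain ⟨r, hr⟩ := exists_eq_pow_mul_of_mem_pow_nr φ h₀ ht hgen (μ := μ + 1) hgr
    -- `φ(u₁)^μ (g′ − φ f y′^μ − φ(u₁) r) = 0`
    have hkey : φ (c 1) ^ μ * (g' - φ f * c' 0 ^ μ - φ (c 1) * r) = 0 := by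
      have h1 : φ (g - f * c 0 ^ μ) = φ (c 1) ^ μ * g' - φ f * (φ (c 1) * c' 0) ^ μ := by
        rw [map_sub, map_mul, map_pow, hg', h₀]
      rw [hr] at h1
      linear_combination -h1
    have hu₁ : φ (c 1) ≠ 0 := by
      intro h0
      have hW : ∀ i, 0 < (fun _ : Fin 3 => (1 : ℕ)) i := fun _ => Nat.one_pos
      have h1 : IsInitialTerm c' (fun _ => 1) (c' 1) (Finsupp.single 1 1) := by
        refine ⟨monomial (Finsupp.single 1 1) 1, isWeightedHomogeneous_monomial _ _ _ rfl, ?_, ?_⟩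
        · rw [coeff_monomial, if_pos rfl]; exact isUnit_one
        · rw [eval_monomial_eq_monom3, one_mul]
          have : monom3 c' (Finsupp.single 1 1) = c' 1 := by simp [monom3]
          rw [this, sub_self]; exact Ideal.zero_mem _
      have := h1.not_mem_succ c' hgen' hdim' hW
      rw [h₁, h0] at this
      exact this (Ideal.zero_mem _)
    have hdiff : g' - φ f * c' 0 ^ μ = φ (c 1) * r := by
      have := (mul_eq_zero.mp hkey).resolve_left (pow_ne_zero _ hu₁)
      linear_combination this
    -- pass to `cs 0 = c′ 0 + Ψ(t) φ(u₁)^{a₀}`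
    have hs : cs 0 - c' 0 = Polynomial.eval₂ φ t Ψ * (c' 1 ^ a₀ * c' 2 ^ 0) := by
      simp [hcs, shiftZ, shiftMon]
    have hdvd : φ (c 1) ∣ g' - φ f * cs 0 ^ μ := by
      have h1 : cs 0 - c' 0 ∣ cs 0 ^ μ - c' 0 ^ μ := sub_dvd_pow_sub_pow _ _ μ
      have h2 : φ (c 1) ∣ cs 0 - c' 0 := by
        rw [hs, pow_zero, mul_one, ← h₁]
        obtain ⟨k, hk⟩ : ∃ k, a₀ = k + 1 := ⟨a₀ - 1, by omega⟩
        exact ⟨Polynomial.eval₂ φ t Ψ * c' 1 ^ k, by rw [hk, pow_succ]; ring⟩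
      have h3 : g' - φ f * cs 0 ^ μ = (g' - φ f * c' 0 ^ μ) - φ f * (cs 0 ^ μ - c' 0 ^ μ) := by ring
      rw [h3, hdiff]
      exact dvd_sub (dvd_mul_right _ _) (dvd_mul_of_dvd_right (h2.trans h1) _)
    refine hasMonic_of_sub_mem_weightedIdealW cs hgenΨ hdim' hJμ' hg'J (hfu.map φ) (N := μ + 1) le_rfl ?_
    obtain ⟨q, hq⟩ := hdvd
    rw [hq]
    refine Ideal.mul_mem_right _ _ ?_
    have : cs 1 ∈ weightedIdealW cs (wN (μ + 1)) (μ + 1) :=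
      span_pair_le_weightedIdealW_wN (c' := cs) (μ + 1) (Ideal.subset_span (by simp))
    rw [← h₁]; exact this
  have hord' : ∃ g ∈ (Submodule.colon (Ideal.map φ J) ({φ (c 1) ^ μ} : Set R')), g ∉ maximalIdeal R' ^ (μ + 1) := hmons.exists_not_mem_pow_succ cs hgenΨ hdim' hJμ'
  -- re-adaptation and `w⁻`-preparation (both keep `α, β`)
  obtain ⟨bt, hgen'', -, hne'', hα'', hβ'', hvprep'', -, hδ''⟩ :=
    exists_readapt cs hgenΨ hdim' hJμ' hnes hv hτs hmons
  set c'' : Fin 3 → R' := shiftZ cs (shiftMon cs bt 1 0) with hc''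
  obtain ⟨cf, hcf1, hcf2, hcf0, hgenf, -, hnef, hαf, hβf, hvprepf, hδf, hwprepf⟩ :=
    exists_wMinusPrepared hdim' _ c'' hgen'' hne'' hδ'' hvprep'' le_rfl
  have hc''0 : c'' 0 = cs 0 + bt * (cs 1 ^ 1 * cs 2 ^ 0) := rfl
  have hc''1 : c'' 1 = cs 1 := rfl
  have hc''2 : c'' 2 = cs 2 := rfl
  have hcs1 : cs 1 = c' 1 := rfl
  have hcs2 : cs 2 = c' 2 := rfl
  have hcs0 : cs 0 = c' 0 + Polynomial.eval₂ φ t Ψ * (c' 1 ^ a₀ * c' 2 ^ 0) := rfl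
  refine ⟨cf, hcf1.trans (hc''1.trans hcs1), hcf2.trans (hc''2.trans hcs2), ?_, hgenf, hnef,
    lt_of_lt_of_le hδ'' hδf, hvprepf, hwprepf, hord', ?_, ?_⟩
  · obtain ⟨k, hk⟩ : ∃ k, a₀ = k + 1 := ⟨a₀ - 1, by omega⟩
    have hsplit : cf 0 - c' 0 = (cf 0 - c'' 0) +
        (bt + Polynomial.eval₂ φ t Ψ * c' 1 ^ k) * c' 1 := by
      rw [hc''0, hcs0, hcs1, hk, pow_zero, mul_one, pow_succ]; ring
    rw [hsplit]
    exact Ideal.add_mem _ (Ideal.mem_sup_right hcf0)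
      (Ideal.mem_sup_left (Ideal.mul_mem_left _ _ (Ideal.subset_span rfl)))
  · rw [hαf, hα'', hαs]
  · rw [hβf, hβ'']; exact hβlt


include h₁ h₀ ht hP hgen hdim hgen' hdim' hres in
/-- **B6-nr — THE PREPARED `β`-DROP AT A NON-RATIONAL VERY NEAR POINT** (CoP1 Lemma 4.5 (2), «hard
part», pp. 12–14; CJS Proposition 14.3 / Theorem 14.4). Input at `x`: `c = (y, u₁, u₂)`, `J ⊆ 𝔪^μ` of
order exactly `μ`, adapted, `w⁻`-prepared, quasi-isolated (`α < 1`); the non-rational chart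
`c′ = (y′, φ u₁, P(t))` of degree `d ≥ 2` with `k(x′) = k(x)(t̄)`; `J′` very near (`J′ ⊆ 𝔪′^μ`, `τ′ = 1`).
Output at `x′`: `cs = (y⋆, φ u₁, P(t))`, `y⋆ − y′ ∈ (φ u₁) + 𝔪′²`, adapted, `𝐯`- and `w⁻`-prepared,
`J′` of order exactly `μ`, `α⋆ + L = δ`, and `β⋆ < β`.
[cite: CossartPiltant2008, Lemma 4.5 (2)] [cite: CossartJannsenSaito2020, Proposition 14.3] -/
theorem exists_prepared_label_nonRationalStep
    {J'' : Ideal R'} (hJ'def : J'' = Submodule.colon (Ideal.map φ J) ({φ (c 1) ^ μ} : Set R'))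
    (hd : 2 ≤ (Polynomial.map (residue R) P).natDegree)
    (hκ : ∀ r : ResidueField R', ∃ G : Polynomial R, residue R' (Polynomial.eval₂ φ t G) = r)
    (hJμ : J ≤ maximalIdeal R ^ μ) (hord : ∃ g ∈ J, g ∉ maximalIdeal R ^ (μ + 1))
    (hne : (pts c J μ).Nonempty) (hδ : μ.factorial < deltaS c J μ) (hα : alphaS c J μ < μ.factorial)
    (hwprep : WMinusPrepared c J μ)
    (hJμ' : J'' ≤ maximalIdeal R' ^ μ) (hτ' : hironakaTauAt c' J'' μ = 1) :
    ∃ cs : Fin 3 → R', cs 1 = c' 1 ∧ cs 2 = c' 2 ∧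
      cs 0 - c' 0 ∈ Ideal.span {c' 1} ⊔ maximalIdeal R' ^ 2 ∧
      Ideal.span {cs 0, cs 1, cs 2} = maximalIdeal R' ∧ (pts cs J'' μ).Nonempty ∧
      μ.factorial < deltaS cs J'' μ ∧ VPrepared cs J'' μ ∧ WMinusPrepared cs J'' μ ∧
      (∃ g ∈ J'', g ∉ maximalIdeal R' ^ (μ + 1)) ∧
      alphaS cs J'' μ + μ.factorial = deltaS c J μ ∧ betaS cs J'' μ < betaS c J μ := by
  by_cases hv : VPrepared c' J'' μ
  · exact exists_prepared_label_nonRationalStep_of_vPrepared φ h₁ h₀ ht hP hgen hdim hgen' hdim' hres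
      hJ'def hd hJμ hord hne hδ hα hJμ' hτ' hv
  · exact exists_prepared_label_nonRationalStep_of_not_vPrepared φ h₁ h₀ ht hP hgen hdim hgen' hdim'
      hres hJ'def hd hκ hJμ hord hne hδ hα hwprep hJμ' hτ' hv

end NonRationalStepB

end Literature.AlgebraicGeometry.Resolution

end
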